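import Summits.BirchSwinnertonDyer.BirchSwinnertonDyer.Theorems.KimAtThreeFineKatoRiderAssembly
import Summits.BirchSwinnertonDyer.BirchSwinnertonDyer.Theorems.KimAtThreeDeepUpperPortSharedOfFineKato
import HarnessLib

/-!
# Crux `KatoKuriharaPortThreeShared` (stmt-BirchSwinnertonDyer-19560) BY NAME from the displayed
# «defined-Kato package» — the composition of this seat's `fineKato_of_definedKatoPackage`
# (`KimAtThreeFineKatoRiderAssembly`, the registered stub `stub_fineKato` = ⟨C1⟩ from the package) with
# w2-c3's `katoKuriharaPortThreeShared_of_fineKato : ⟨C1⟩ → crux` (p471554)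
# (cell `bsd-addord`, seat kim3 gen 13; route W2 `KimAtThreeKolyvagin`; `--supports 19560`, helper)

HONEST FRAMING. ONE theorem, no definition, no named fact, no `sorry`; the package `hK` is a DISPLAYED
hypothesis, so this does NOT close 19560; nothing is booked; BSD is not proved.  It records the crux's
residual in the kernel in its sharpest current form: **19560 ⟸ hK**, where `hK` (per Kato-stratum row:
Kato's `(ι, κ, Λ)` with a `ℚ₃`-component `φ = exp*_ω`, R-κ, the ℚ₃-level print facts [BK90] 3.8/3.11 +
Tate duality for `φ`, the semi-local SAT₀/COMPAT package for `(Λ, φ)`, and Kato's `ZetaBody` family —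
see `KimAtThreeFineKatoRiderAssembly`'s docstring) contains NO rider predicate `KatoExpStarFiniteLevelAt`
and NO finite-level functional: those are now constructed/proved in the kernel (kim3 g13 p490100 + the
assembly file; w2-acc4 p477821).  This file lives in the route file's import cone by necessity (it
concludes the crux by name through w2-c3's closer-shaped theorem).
-/

noncomputable section

-- the cell's Theorems namespace `Summit.BirchSwinnertonDyer.BirchSwinnertonDyer.…` repeats the summit name by design (D-0017)
set_option linter.dupNamespace false

open scoped Classical NumberField TensorProduct ContRepresentation
open Field NumberField IsDedekindDomain
open WeierstrassCurve Literature.NumberTheory.EllipticCurves Literature.NumberTheory.GaloisRepresentations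
  Literature.NumberTheory.GaloisRepresentations.DiscreteGaloisModule Literature.NumberTheory.GaloisCohomology
open Literature.NumberTheory.EllipticCurves.ModularForms Literature.NumberTheory.EllipticCurves.Rank1Residual
open Literature.NumberTheory.EllipticCurves.Kato2004 Literature.NumberTheory.EllipticCurves.Kato2004.EulerSystemValues
open Summit.BirchSwinnertonDyer.Rank1Residual.GaloisImage
open Summit.BirchSwinnertonDyer.Rank1Residual.Additive.LocalLog
open Summit.BirchSwinnertonDyer.BirchSwinnertonDyer.Theorems

namespace Summit.BirchSwinnertonDyer.BirchSwinnertonDyer.Theorems.KimAtThreeFineKatoRiderAssemblyCrux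

/-- **Crux `KatoKuriharaPortThreeShared` BY NAME from the displayed defined-Kato package `hK`**
(`fineKato_of_definedKatoPackage` then w2-c3's `katoKuriharaPortThreeShared_of_fineKato`).  `hK`
displayed — NOT a closing theorem.
[cite: Kato2004Asterisque, (8.1.3) (p. 180), Prop. 8.12 (p. 186), §9.4 and Thm. 9.7 (pp. 188–189), Thm. 6.6 (1) (p. 163), Ex. 13.3 (pp. 224–225)]
[cite: BlochKato1990, §3 (Prop. 3.8, Ex. 3.11)] [cite: Kim2022StructureSelmer, §3.3–§3.4.1 and Thm. 3.13]
[cite: MazurRubin2004, Thm. 3.2.4 and App. A Remark A.5] -/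
theorem katoKuriharaPortThreeShared_of_definedKatoPackage
    (hK : ∀ (W : WeierstrassCurve ℚ) [W.IsElliptic] [W.IsGloballyMinimal]
      [ContinuousSMul ℤ_[3] (W.tateModule 3)] [Module.Free ℤ_[3] (W.tateModule 3)]
      [Module.Finite ℤ_[3] (W.tateModule 3)],
      (∀ m : ℕ, W.HasSurjectiveModNGaloisRep (3 ^ m : ℕ)) →
      (haveI : Fact (Nat.Prime 3) := ⟨Nat.prime_three⟩; Addv W 3) →
      ¬ 3 ∣ (W.baseChange ℚ_[3]).localTamagawaNumber ℤ_[3] →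
      Nat.card {Q : (W.baseChange ℚ_[3]).toAffine.Point // (3 : ℕ) • Q = 0} = 1 →
      ∀ (v₃ : HeightOneSpectrum (𝓞 ℚ)), ((3 : ℕ) : 𝓞 ℚ) ∈ v₃.asIdeal →
      ∀ {N : ℕ} [NeZero N] (P : ModularParametrizationData W N), N = W.conductorNorm ℤ →
        (∀ z ∈ P.L.lattice, ∃ w ∈ periodLattice P.f, z = P.c * w) →
        ¬ (3 : ℤ) ∣ P.maninConstant →
        ∃ (ι : (n : ℕ) → (CyclotomicField n ℚ →+* ℂ)) (κK : ℝ)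
          (Λ : ∀ (k' : ℕ) (r : Finset (HeightOneSpectrum (𝓞 ℚ))),
            H1 (tateRep W 3) (cycSubgroup 3 k' r) →ₗ[ℤ_[3]]
              ℚ_[3] ⊗[ℚ] CyclotomicField (cycLevel 3 k' r) ℚ)
          (φ : (tateLocalRep W 3 (Sum.inr v₃)).cohomology 1 →+ ℚ_[3]),
          κK ≠ 0 ∧ (∃ u : ℚ, (u : ℝ) = κK ∧ padicValRat 3 u = 0) ∧
          (∀ y, φ y = 0 ↔ ∀ j : ℕ, tateLocalMap W 3 j (Sum.inr v₃) y ∈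
            W.kummerSelmerStructure (((3 : ℕ) : ℤ) ^ j * ((3 : ℕ) : ℤ)) (Sum.inr v₃)) ∧
          (∀ a : ℚ_[3], (∃ y, φ y = a) ↔
            ∀ Q : (W.baseChange ℚ_[3]).toAffine.Point, ‖a * padicLog (W.baseChange ℚ_[3]) Q‖ ≤ 1) ∧
          (∀ (j : ℕ) (r : Finset (HeightOneSpectrum (𝓞 ℚ))),
          ∃ (Λ₀ : Set (ℚ_[3] ⊗[ℚ] CyclotomicField (cycLevel 3 0 r) ℚ))
            (M : Submodule ℤ_[3] (ℚ_[3] ⊗[ℚ] CyclotomicField (cycLevel 3 0 r) ℚ)),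
            Λ₀ ⊆ cycIntLattice 3 (cycLevel 3 0 r) ∧
            (∃ ℓ ∈ Λ₀, ‖Algebra.trace ℚ_[3] (ℚ_[3] ⊗[ℚ] CyclotomicField (cycLevel 3 0 r) ℚ) ℓ‖ = 1) ∧
            (∀ μ ∈ M, ∀ ℓ ∈ Λ₀,
              ‖Algebra.trace ℚ_[3] (ℚ_[3] ⊗[ℚ] CyclotomicField (cycLevel 3 0 r) ℚ) (μ * ℓ)‖ ≤ 1) ∧
            ∀ (Ψ : H1 (tateRep W 3) (cycSubgroup 3 0 r) →+
                continuousCohomology 1 (subgroupRep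
                  (W.torsionGaloisModule (((3 : ℕ) : ℤ) ^ j * ((3 : ℕ) : ℤ))).toTopRep (cycSubgroup 3 0 r))),
              (∀ (φ' : contOneCocycles (subgroupRep (tateRep W 3).toTopRep (cycSubgroup 3 0 r)))
                  (ψ : contOneCocycles (subgroupRep
                    (W.torsionGaloisModule (((3 : ℕ) : ℤ) ^ j * ((3 : ℕ) : ℤ))).toTopRep (cycSubgroup 3 0 r))),
                  (∀ g, ((ψ.1 g : geomTorsion W (((3 : ℕ) : ℤ) ^ j * ((3 : ℕ) : ℤ))) : geomPoints W) =
                    TateModule.proj 3 (j + 1) (φ'.1 g)) →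
                  Ψ (oneCocycleClass _ φ') = oneCocycleClass _ ψ) →
              ∀ (y : H1 (tateRep W 3) (cycSubgroup 3 0 r))
                (κ₀ : galoisCohomology (W.torsionGaloisModule (((3 : ℕ) : ℤ) ^ j * ((3 : ℕ) : ℤ))) 1)
                (h : (tateLocalRep W 3 (Sum.inr v₃)).cohomology 1),
                resSubgroup (W.torsionGaloisModule (((3 : ℕ) : ℤ) ^ j * ((3 : ℕ) : ℤ))).toTopRep
                    (cycSubgroup 3 0 r) 1 κ₀ = Ψ y →
                galoisCohomology.localization (W.torsionGaloisModule (((3 : ℕ) : ℤ) ^ j * ((3 : ℕ) : ℤ)))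
                    (Sum.inr v₃) 1 κ₀ = tateLocalMap W 3 j (Sum.inr v₃) h →
                ∃ μ ∈ M, (φ h ⊗ₜ[ℚ] (1 : CyclotomicField (cycLevel 3 0 r) ℚ)) -
                    (((3 : ℕ) : ℤ_[3]) ^ (0 : ℕ)) • Λ 0 r y = (((3 : ℕ) : ℤ_[3]) ^ (j + 1)) • (μ : _)) ∧
          ∀ (c d a : ℤ) (A : ℕ), 0 < A → Int.gcd c (6 * 3 * A) = 1 → Int.gcd d (6 * 3 * N) = 1 →
            ∃ (z : ∀ (k' : ℕ) (r : (cyclotomicLevelsRat 3 (badPlaces c d A N)).Ideals),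
                  H1 (tateRep W 3) ((cyclotomicLevelsRat 3 (badPlaces c d A N)).level k' r.1))
              (x : ∀ (k' : ℕ) (r : (cyclotomicLevelsRat 3 (badPlaces c d A N)).Ideals),
                  CyclotomicField (cycLevel 3 k' r.1) ℚ),
              ZetaBody W 3 P.f ι κK Λ c d a A z x) :
    Summit.BirchSwinnertonDyer.BirchSwinnertonDyer.Theses.KimAtThreeKolyvagin.KatoKuriharaPortThreeShared :=
  KimAtThreeDeepUpperPortSharedOfFineKato.katoKuriharaPortThreeShared_of_fineKato
    (KimAtThreeFineKatoRiderAssembly.fineKato_of_definedKatoPackage hK)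

end Summit.BirchSwinnertonDyer.BirchSwinnertonDyer.Theorems.KimAtThreeFineKatoRiderAssemblyCrux

end
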